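import Mathlib
import HarnessLib
import Literature.Probability.MarkovChains.PseudoMarginalAcceptance
import Literature.Probability.MarkovChains.PeskunOrdering

/-!
# Pseudo-marginal versus marginal Metropolis–Hastings: the asymptotic-variance order

HONEST FRAMING: exact (Metropolis-corrected) sampling algorithms for lattice gauge theory;
figures of merit are autocorrelation/cost numbers at stated couplings and volumes; no
continuum-physics claim.

Setting (finite form; the vocabulary of `PseudoMarginal.lean`, `PseudoMarginalAcceptance.lean` and
`PeskunOrdering.lean`).  `X` is a finite state space with a positive probability vector `π`,
`T : X → X → ℝ` a non-negative proposal matrix with row sums `≤ 1`, `Ξ` a finite noise space with a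
positive law `g` (`Σ g = 1`), and `f : X → Ξ → ℝ`, positive, an UNBIASED estimator of the target,
`Σ_ξ g ξ · f x ξ = π x`.  The MARGINAL algorithm is the Metropolis–Hastings chain
`P = mhKernel T π` on `X`; the PSEUDO-MARGINAL algorithm is the Metropolis–Hastings chain
`P̃ = PseudoMarginal.kernel T f g` on `X × Ξ` for the extended weight `π̃ = target f g`
(`π̃ (x, ξ) = g ξ · f x ξ`, the finite form of `π̃(dx × dw) = π(dx) Q_x(dw) w`).  A function
`u : X → ℝ` is read on the extended space as `lift u (x, ξ) = u x` ("`f̃(x, ·) ≡ f(x)`"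
[cite: AndrieuVihola2015, Theorem 7]; "for functions `f : X → ℝ` we will also denote … by `f` the
functions from `X × ℝ₊ → ℝ` defined by `f(x,w) := f(x)`" [cite: AndrieuVihola2016, §3]).  The
asymptotic variance is Peskun's / Kemeny–Snell's `asympVar` (`v(f, π, P) = 2⟨f̄, Z f̄⟩_π − ‖f̄‖²_π`,
`asympVar_eq_centred`; it is `lim N⁻¹ var[Σ_{t ≤ N} f(X_t)]`, `tendsto_varSum_div`).

The printed results formalised here:

* `PseudoMarginal.dirichletForm_kernel_lift`, `dirichletForm_mhKernel_eq` — the Dirichlet forms of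
  a lifted function under `P̃` and of a function under `P`, in flow form:
  `𝓔_P̃(ũ) = ½ Σ_{x,y} flow T f g x y (u x − u y)² = ½ Δ_P̃(g_u)` and
  `𝓔_P(u) = ½ Σ_{x,y} π x · mhRate T π x y · (u x − u y)² = ½ Δ_P̄(g_u)` with `g_u(x,y) = (u x − u y)²`
  [cite: AndrieuVihola2015, §2 Proposition 2 (the functionals `Δ_P̄(g)`, `Δ_P̃(g)`) and §3 proof of
  Theorem 7 ("a straightforward calculation (cf. (eq:dirichlet-form)) shows that
  `⟨φ_λ, (P̃ − P̄)φ_λ⟩_π̃ = ½[Δ_P̄(g_λ) − Δ_P̃(g_λ)]`")].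
* `PseudoMarginal.dirichletForm_lift_le` — [cite: AndrieuVihola2016, Theorem 10 (b) with Remark 14
  (the marginal algorithm is the case `Q_x ≡ δ_1`)]: `𝓔_P̃(ũ) ≤ 𝓔_P(u)` for every `u : X → ℝ`;
  equivalently [cite: AndrieuVihola2015, §2 Proposition 2 (`Δ_P̄(g) ≥ Δ_P̃(g)`)] at `g = g_u`.
  `PseudoMarginal.dirichletForm_lift_mono_of_isCxLE` — [cite: AndrieuVihola2016, Theorem 10 (b)] in
  general: `{Q_x^{(1)}} ≤cx {Q_x^{(2)}}` gives `𝓔_{P̃₁}(ũ) ≥ 𝓔_{P̃₂}(ũ)`.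
* `PseudoMarginal.asympVar_lift_sub_asympVar_eq` — the finite (`λ = 1`) face of the display
  (eq:var-bound) in the proof of [cite: AndrieuVihola2015, Theorem 7]:
  `v(ũ, π̃, P̃) − v(u, π, P) = 2[𝓔_P(h) − 𝓔_P̃(h̃)] + 2 𝓔_P̃(Z̃ ū̃ − h̃)` with `h = Z_P ū` the centred
  Poisson solution of the marginal chain and `Z̃` the fundamental matrix of `P̃` — the FIRST-ORDER term
  `⟨f̄, A'_λ(0) f̄⟩ = 2λ⟨φ_λ, (P̃ − P̄)φ_λ⟩ = λ[Δ_P̄(g_λ) − Δ_P̃(g_λ)]` (here `φ = h`) plus a non-negative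
  REMAINDER (printed: `∫∫⟨f̄, A''_λ(γ)f̄⟩ = 4λ² ∫∫⟨ϕ, (I − λH_γ)⁻¹ϕ⟩ ≥ 0`; here a Dirichlet form).
* `PseudoMarginal.asympVar_le_asympVar_lift'` — [cite: AndrieuVihola2015, Theorem 7 (ii)]:
  `v(ũ, P̃) ≥ v(u, P) + [Δ_P̄(g_h) − Δ_P̃(g_h)]` (finite form, `λ = 1`, `φ_λ → h`).
* **`PseudoMarginal.asympVar_le_asympVar_lift`** — [cite: AndrieuVihola2015, Theorem 7 (i)]:
  "Then, `var(f, P̃) ≥ var(f, P)`" — a pseudo-marginal algorithm is always dominated by its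
  marginal algorithm in terms of asymptotic variance, for EVERY observable of the state and every
  proposal matrix; `PseudoMarginal.asympVar_div_var_le` is the same in units of the (common)
  stationary variance `var_π(u) = var_π̃(ũ)`, i.e. for the integrated autocorrelation times
  (`var(f, Π) = τ(f, Π) var_μ(f)` [cite: AndrieuVihola2015, §2 Definition 6]).

PROOF ROUTE.  The printed proof [cite: AndrieuVihola2015, §3 (proof of Theorem 7)] (i) replaces `P`
by the kernel `P̄` on `X × Ξ` that moves `x` by the marginal chain and refreshes the weight, so that
`var(f, P̄) = var(f, P)` ("coincides marginally with the marginal chain"); (ii) expands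
`var_λ(f̄, P̃) − var_λ(f̄, P̄)` to second order along `H_β = P̄ + β(P̃ − P̄)` with the operator
calculus of its Appendix; (iii) shows the first-order term is `≥ 0` by Proposition 2 — the point being
that `φ_λ = (I − λP̄)⁻¹f̄` depends on `x` only, so Proposition 2 applies ("we cannot use [Tierney's]
argument directly because Proposition 2 does not apply to functions depending also on `u` and `w`");
(iv) shows the remainder is `≥ 0`; (v) lets `λ → 1`.  Finite rendering, same architecture: (i) is the
pair `piInner_lift` / `centred_lift` (a lifted function has the same `π̃`-moments as under `π`, by
unbiasedness) — `P̄` itself is never needed; (ii) at `λ = 1` (a finite irreducible chain, `Z` a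
genuine inverse) the expansion with its remainder is the EXACT identity
`asympVar_lift_sub_asympVar_eq`, obtained from the tree's Bellman / Caracciolo–Pelissetto–Sokal
variational identity `variational_identity` (file `PeskunOrdering.lean`,
[cite: AndrieuVihola2016, §4 Lemma 16]) evaluated at the LIFTED marginal solution `h̃` — a
genuinely shorter road than the resolvent calculus, and again the only point is that `h̃` depends on
`x` only; (iii) is `dirichletForm_lift_le` (the tree's `flow_le_mul_mhRate` = Lemma 1, termwise);
(iv) is `dirichletForm_nonneg`; (v) is not needed.  Irreducibility is assumed for the chain that is
RUN, `P̃`; that of `P` follows (a positive `P̃`-path projects to a positive `P`-path).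

Deliberately NOT here: [cite: AndrieuVihola2016, Theorem 10 (c)–(e)] (the asymptotic-variance and
spectral-gap orders between TWO pseudo-marginal algorithms in the convex order — the printed proof
(§5) needs a martingale (Strassen) coupling of the two weight laws; TODO(general form)); general
state spaces and infinite variances (the printed Theorem 7 "does not assume the finiteness of the
asymptotic variances" — here both chains are finite and irreducible, so both variances are the
finite Kemeny–Snell values); the converse transfer "`P̃` is also irreducible and aperiodic if the
marginal kernel `P` is" [cite: AndrieuVihola2015, §8 (after Theorem 50)].

Context: cell pub-lqcd (venture LatticeQCDFlow), R2-SCOPE.md §3 E2 (routes D1/D2: a stochastic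
fermion-determinant estimate in the accept step), §4 C-PM, §6 reason (5) ("fermions can only cost"):
with `pmAccept_le_mhAccept` (the noise lowers the acceptance rate) this file adds the second half of
that sentence — the noise RAISES the integrated autocorrelation time of every gauge-field observable,
at any proposal, exactly-trained flow proposals included.
-/

namespace Literature.Probability.MarkovChains

open Finset Matrix

variable {X : Type*} [Fintype X] [DecidableEq X]

/-! ## The marginal chain's Dirichlet form in flow form -/

/-- A diagonal term of a Dirichlet-form double sum vanishes (private helper). [folklore] -/
private theorem mul_sub_self_sq (a b : ℝ) : a * (b - b) ^ 2 = 0 := by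
  rw [sub_self, zero_pow two_ne_zero, mul_zero]

/-- `𝓔_P(u) = ½ Σ_x Σ_y π x · mhRate T π x y · (u x − u y)²` for the Metropolis–Hastings chain
`P = mhKernel T π`: only genuine moves contribute, each with the stationary flow
`π x · mhRate T π x y = min(π x T x y, π y T y x)` — the functional `½ Δ_P̄(g)` of Andrieu–Vihola at
`g(x,y) = (u x − u y)²` (`Δ_P̄(g) = ∫ π̃(dx,dw) ∫ q(x,dy) π_y(du) min{1, r(x,y)} g(x,y)
= Σ_x π(x) Σ_y q(x,y) min{1, r(x,y)} g(x,y)`). [cite: AndrieuVihola2015, §2 Proposition 2 (definition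
of `Δ_P̄`) and §3 (proof of Theorem 7, "cf. (eq:dirichlet-form)")];
[cite: AndrieuVihola2016, §3 (`𝓔_Π(f) = ½∫μ(dx)Π(x,dy)(f(x) − f(y))²`)] -/
theorem dirichletForm_mhKernel_eq (T : X → X → ℝ) (π : X → ℝ) (u : X → ℝ) :
    dirichletForm π (mhKernel T π) u = (1 / 2) * ∑ x, ∑ y, π x * mhRate T π x y * (u x - u y) ^ 2 := by
  unfold dirichletForm
  congr 1
  refine sum_congr rfl fun x _ => sum_congr rfl fun y _ => ?_
  by_cases hxy : y = x
  · subst hxy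
    rw [mul_sub_self_sq, mul_sub_self_sq]
  · rw [show (mhKernel T π : Matrix X X ℝ) x y = mhRate T π x y from mhKernel_of_ne hxy]

namespace PseudoMarginal

variable {Ξ : Type*} [Fintype Ξ] [DecidableEq Ξ]

/-! ## Lifting observables of the state to the extended space -/

omit [Fintype X] [DecidableEq X] [Fintype Ξ] [DecidableEq Ξ] in
/-- An observable of the state read on the extended space `X × Ξ`: `lift u (x, ξ) = u x`
("`f̃(x, ·) ≡ f(x)`"). [cite: AndrieuVihola2015, Theorem 7 (the notation `f̃`)];
[cite: AndrieuVihola2016, §3 ("`f(x,w) := f(x)`")] -/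
def lift (u : X → ℝ) : X × Ξ → ℝ := fun z => u z.1

omit [Fintype X] [DecidableEq X] [Fintype Ξ] [DecidableEq Ξ] in
/-- `lift u (x, ξ) = u x`. [cite: AndrieuVihola2015, Theorem 7 (the notation `f̃`)] -/
@[simp] theorem lift_apply (u : X → ℝ) (z : X × Ξ) : (lift u : X × Ξ → ℝ) z = u z.1 := rfl

omit [Fintype X] [DecidableEq X] [Fintype Ξ] [DecidableEq Ξ] in
/-- Lifting commutes with subtraction. [cite: AndrieuVihola2015, Theorem 7 (the notation `f̃`)] -/
theorem lift_sub (u v : X → ℝ) : (lift (u - v) : X × Ξ → ℝ) = lift u - lift v := rfl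

omit [DecidableEq X] [DecidableEq Ξ] in
/-- **Marginal coincidence of moments**: `⟨ũ, ṽ⟩_π̃ = ⟨u, v⟩_π` — under unbiasedness the extended
weight has `X`-marginal `π`, so lifted observables have the same stationary moments (the finite face
of "`(X̄_n)` … coincides marginally with the marginal chain … Therefore `var(f, P̄) = var(f, P)`",
as far as one-time moments go). [cite: AndrieuVihola2015, §3 (proof of Theorem 7, first paragraph)];
[cite: AndrieuVihola2016, §1 ("`π̃(dx × dw) = π(dx)Q_x(dw)w` … such that `∫ w Q_x(dw) = 1`")] -/
theorem piInner_lift {f : X → Ξ → ℝ} {g : Ξ → ℝ} {π : X → ℝ}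
    (hunb : ∀ x, ∑ ξ, g ξ * f x ξ = π x) (u v : X → ℝ) :
    piInner (target f g) (lift u : X × Ξ → ℝ) (lift v) = piInner π u v :=
  sum_target_mul hunb fun x => u x * v x

omit [DecidableEq X] [DecidableEq Ξ] in
/-- The `π̃`-mean of a lifted observable is its `π`-mean: `Σ_{(x,ξ)} π̃(x,ξ) u x = Σ_x π x u x`.
[cite: AndrieuVihola2015, §3 (proof of Theorem 7: "`f̄ ∈ L²₀(X × W, π̃)`")] -/
theorem sum_target_mul_lift {f : X → Ξ → ℝ} {g : Ξ → ℝ} {π : X → ℝ}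
    (hunb : ∀ x, ∑ ξ, g ξ * f x ξ = π x) (u : X → ℝ) :
    ∑ z : X × Ξ, target f g z * (lift u : X × Ξ → ℝ) z = ∑ x, π x * u x :=
  sum_target_mul hunb u

omit [DecidableEq X] [DecidableEq Ξ] in
/-- Centring commutes with lifting: `centred π̃ ũ = lift (centred π u)` ("with a slight abuse of
notation define `f̄(x,w) := f̄(x)` … Notice that `f̄ ∈ L²₀(X × W, π̃)`").
[cite: AndrieuVihola2015, §3 (proof of Theorem 7)] -/
theorem centred_lift {f : X → Ξ → ℝ} {g : Ξ → ℝ} {π : X → ℝ}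
    (hunb : ∀ x, ∑ ξ, g ξ * f x ξ = π x) (u : X → ℝ) :
    centred (target f g) (lift u : X × Ξ → ℝ) = lift (centred π u) := by
  funext z
  simp only [centred, lift_apply]
  rw [sum_target_mul hunb u]

/-! ## The pseudo-marginal chain's Dirichlet form on lifted observables -/

/-- `𝓔_P̃(ũ) = ½ Σ_x Σ_y flow T f g x y · (u x − u y)²`: on a lifted observable only the moves of the
STATE contribute, each with the stationary `x → y` flow of the pseudo-marginal chain summed over the
recycled and the fresh noise — the functional `½ Δ_P̃(g)` at `g(x,y) = (u x − u y)²`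
(`Δ_P̃(g) = ∫ π̃(dx,dw) ∫ q(x,dy) Q_y(du) min{1, r(x,y) u/w} g(x,y)`).
[cite: AndrieuVihola2015, §2 Proposition 2 (definition of `Δ_P̃`) and §3 (proof of Theorem 7: "a
straightforward calculation (cf. (eq:dirichlet-form)) shows that
`⟨φ_λ, (P̃ − P̄)φ_λ⟩_π̃ = ½[Δ_P̄(g_λ) − Δ_P̃(g_λ)]`")] -/
theorem dirichletForm_kernel_lift (T : X → X → ℝ) (f : X → Ξ → ℝ) (g : Ξ → ℝ) (u : X → ℝ) :
    dirichletForm (target f g) (kernel T f g) (lift u : X × Ξ → ℝ) =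
      (1 / 2) * ∑ x, ∑ y, flow T f g x y * (u x - u y) ^ 2 := by
  unfold dirichletForm
  congr 1
  calc ∑ z : X × Ξ, ∑ z' : X × Ξ,
        target f g z * (kernel T f g : Matrix (X × Ξ) (X × Ξ) ℝ) z z' *
          ((lift u : X × Ξ → ℝ) z - (lift u : X × Ξ → ℝ) z') ^ 2
      = ∑ x, ∑ ξ, ∑ y, ∑ ξ',
          target f g (x, ξ) * kernel T f g (x, ξ) (y, ξ') * (u x - u y) ^ 2 := by
        rw [Fintype.sum_prod_type]
        refine sum_congr rfl fun x _ => sum_congr rfl fun ξ _ => ?_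
        rw [Fintype.sum_prod_type]
        rfl
    _ = ∑ x, ∑ y, (∑ ξ, ∑ ξ', target f g (x, ξ) * kernel T f g (x, ξ) (y, ξ')) * (u x - u y) ^ 2 := by
        refine sum_congr rfl fun x _ => ?_
        rw [sum_comm]
        refine sum_congr rfl fun y _ => ?_
        rw [sum_mul]
        exact sum_congr rfl fun ξ _ => by rw [sum_mul]
    _ = ∑ x, ∑ y, flow T f g x y * (u x - u y) ^ 2 := by
        refine sum_congr rfl fun x _ => sum_congr rfl fun y _ => ?_
        by_cases hxy : x = y
        · subst hxy
          rw [mul_sub_self_sq, mul_sub_self_sq]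
        · congr 1
          refine sum_congr rfl fun ξ _ => sum_congr rfl fun ξ' _ => ?_
          have hne : (y, ξ') ≠ (x, ξ) := fun h => hxy (Prod.mk.inj h).1.symm
          rw [show kernel T f g (x, ξ) (y, ξ') = mhRate (proposal T g) (target f g) (x, ξ) (y, ξ')
            from mhKernel_of_ne hne]

/-- **Andrieu–Vihola 2016, Theorem 10 (b), marginal case / 2015, Proposition 2 in Dirichlet-form
language**: `𝓔_P̃(ũ) ≤ 𝓔_P(u)` for every observable `u` of the state — the pseudo-marginal chain
has the SMALLER Dirichlet form on lifted functions (termwise: `flow T f g x y ≤ π x · mhRate T π x y`,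
Lemma 1).  "for any `f : X → ℝ`, the Dirichlet forms satisfy `𝓔_{P̃₁}(f) ≥ 𝓔_{P̃₂}(f)`" with `P̃₁`
the marginal algorithm (`Q_x ≡ δ_1`). [cite: AndrieuVihola2016, Theorem 10 (b) with Remark 14];
[cite: AndrieuVihola2015, §2 Proposition 2 ("Then we have `Δ_P̄(g) ≥ Δ_P̃(g)`")] -/
theorem dirichletForm_lift_le {f : X → Ξ → ℝ} {g : Ξ → ℝ} {π : X → ℝ} (hf : ∀ x ξ, 0 < f x ξ)
    (hg : ∀ ξ, 0 < g ξ) (hg1 : ∑ ξ, g ξ = 1) (hunb : ∀ x, ∑ ξ, g ξ * f x ξ = π x)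
    (hπ : ∀ x, 0 < π x) (T : X → X → ℝ) (u : X → ℝ) :
    dirichletForm (target f g) (kernel T f g) (lift u : X × Ξ → ℝ) ≤
      dirichletForm π (mhKernel T π) u := by
  rw [dirichletForm_kernel_lift, dirichletForm_mhKernel_eq]
  refine mul_le_mul_of_nonneg_left (sum_le_sum fun x _ => sum_le_sum fun y _ => ?_) (by norm_num)
  exact mul_le_mul_of_nonneg_right (flow_le_mul_mhRate hf hg hg1 hunb hπ T x y) (sq_nonneg _)

/-- The difference of the two Dirichlet forms in flow form:
`2[𝓔_P(u) − 𝓔_P̃(ũ)] = Σ_x Σ_y (π x · mhRate T π x y − flow T f g x y)(u x − u y)² = Δ_P̄(g) − Δ_P̃(g)`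
at `g(x,y) = (u x − u y)²`. [cite: AndrieuVihola2015, §3 (proof of Theorem 7:
"`⟨φ_λ, (P̃ − P̄)φ_λ⟩_π̃ = … = ½[Δ_P̄(g_λ) − Δ_P̃(g_λ)]`")] -/
theorem two_mul_dirichletForm_sub_eq {f : X → Ξ → ℝ} {g : Ξ → ℝ} (T : X → X → ℝ) (π : X → ℝ)
    (u : X → ℝ) :
    2 * (dirichletForm π (mhKernel T π) u
        - dirichletForm (target f g) (kernel T f g) (lift u : X × Ξ → ℝ)) =
      ∑ x, ∑ y, (π x * mhRate T π x y - flow T f g x y) * (u x - u y) ^ 2 := by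
  rw [dirichletForm_kernel_lift, dirichletForm_mhKernel_eq]
  simp_rw [sub_mul, sum_sub_distrib]
  ring

/-! ## Theorem 10 (b): the convex order of the weights orders the Dirichlet forms -/

section ConvexOrder

variable {Ξ₁ Ξ₂ : Type*} [Fintype Ξ₁] [DecidableEq Ξ₁] [Fintype Ξ₂] [DecidableEq Ξ₂]

/-- **Andrieu–Vihola 2016, Theorem 10 (b)** (finite form): two pseudo-marginal approximations of the
same marginal algorithm (same `π`, same proposal matrix `T`) whose normalised weight laws satisfy
`Q_x^{(1)} ≤cx Q_x^{(2)}` for every `x` have ordered Dirichlet forms on observables of the state,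
`𝓔_{P̃₂}(ũ) ≤ 𝓔_{P̃₁}(ũ)` — "for any `f : X → ℝ`, the Dirichlet forms satisfy
`𝓔_{P̃₁}(f) ≥ 𝓔_{P̃₂}(f)`": less variable weights (in the convex order) MIX the state better.
Termwise from Theorem 10 (a) (`flow_mono_of_isCxLE`). [cite: AndrieuVihola2016, Theorem 10 (b)] -/
theorem dirichletForm_lift_mono_of_isCxLE {f₁ : X → Ξ₁ → ℝ} {g₁ : Ξ₁ → ℝ} {f₂ : X → Ξ₂ → ℝ}
    {g₂ : Ξ₂ → ℝ} {π : X → ℝ} (hf₁ : ∀ x ξ, 0 < f₁ x ξ) (hg₁ : ∀ ξ, 0 < g₁ ξ)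
    (hf₂ : ∀ x ξ, 0 < f₂ x ξ) (hg₂ : ∀ ξ, 0 < g₂ ξ) (hπ : ∀ x, 0 < π x)
    (hcx : ∀ x, IsCxLE g₁ (fun ξ => f₁ x ξ / π x) g₂ (fun ξ => f₂ x ξ / π x))
    (T : X → X → ℝ) (u : X → ℝ) :
    dirichletForm (target f₂ g₂) (kernel T f₂ g₂) (lift u : X × Ξ₂ → ℝ) ≤
      dirichletForm (target f₁ g₁) (kernel T f₁ g₁) (lift u : X × Ξ₁ → ℝ) := by
  rw [dirichletForm_kernel_lift, dirichletForm_kernel_lift]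
  refine mul_le_mul_of_nonneg_left (sum_le_sum fun x _ => sum_le_sum fun y _ => ?_) (by norm_num)
  exact mul_le_mul_of_nonneg_right (flow_mono_of_isCxLE hf₁ hg₁ hf₂ hg₂ hπ T (hcx x) (hcx y))
    (sq_nonneg _)

end ConvexOrder

/-! ## Irreducibility passes from the pseudo-marginal chain to the marginal chain -/

/-- Powers of an entrywise non-negative matrix are entrywise non-negative (private helper).
[folklore] -/
private theorem pow_apply_nonneg {Y : Type*} [Fintype Y] [DecidableEq Y] {P : Matrix Y Y ℝ}
    (hP : ∀ a b, 0 ≤ P a b) : ∀ (n : ℕ) (a b : Y), 0 ≤ (P ^ n) a b := by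
  intro n
  induction n with
  | zero =>
      intro a b
      rw [pow_zero, Matrix.one_apply]
      split_ifs <;> norm_num
  | succ n ih =>
      intro a b
      rw [pow_succ, Matrix.mul_apply]
      exact sum_nonneg fun c _ => mul_nonneg (ih a c) (hP c b)

/-- A positive product of two non-negative reals has positive factors (private helper). [folklore] -/
private theorem pos_and_pos_of_mul_pos {a b : ℝ} (ha : 0 ≤ a) (hb : 0 ≤ b) (h : 0 < a * b) :
    0 < a ∧ 0 < b := by
  refine ⟨lt_of_le_of_ne ha fun h0 => ?_, lt_of_le_of_ne hb fun h0 => ?_⟩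
  · rw [← h0, zero_mul] at h; exact lt_irrefl 0 h
  · rw [← h0, mul_zero] at h; exact lt_irrefl 0 h

/-- A genuine move of the pseudo-marginal chain is a possible move of the marginal chain: if
`P̃((a,ξ),(b,ξ')) > 0` with `a ≠ b` then `T a b > 0 < T b a`, hence `mhRate T π a b > 0`
(private helper). [folklore] -/
private theorem mhRate_pos_of_kernel_pos {f : X → Ξ → ℝ} {g : Ξ → ℝ} {π : X → ℝ}
    (hf : ∀ x ξ, 0 < f x ξ) (hg : ∀ ξ, 0 < g ξ) (hπ : ∀ x, 0 < π x) {T : X → X → ℝ}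
    (hT : ∀ x y, 0 ≤ T x y) {a b : X} {ξ ξ' : Ξ} (hab : a ≠ b)
    (hpos : 0 < kernel T f g (a, ξ) (b, ξ')) : 0 < mhRate T π a b := by
  have hne : (b, ξ') ≠ (a, ξ) := fun h => hab (Prod.mk.inj h).1.symm
  rw [show kernel T f g (a, ξ) (b, ξ') = mhRate (proposal T g) (target f g) (a, ξ) (b, ξ')
    from mhKernel_of_ne hne, rate_eq hf hg T a b ξ ξ'] at hpos
  have hmin : 0 < min (T a b) (f b ξ' * T b a / f a ξ) :=
    (pos_and_pos_of_mul_pos (hg ξ').le (le_min (hT a b)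
      (div_nonneg (mul_nonneg (hf b ξ').le (hT b a)) (hf a ξ).le)) hpos).2
  have hTab : 0 < T a b := lt_of_lt_of_le hmin (min_le_left _ _)
  have hTba : 0 < T b a := by
    by_contra hle
    have h0 : T b a = 0 := le_antisymm (not_lt.mp hle) (hT b a)
    have := lt_of_lt_of_le hmin (min_le_right _ _)
    rw [h0, mul_zero, zero_div] at this
    exact lt_irrefl 0 this
  exact lt_min hTab (div_pos (mul_pos (hπ b) hTba) (hπ a))

/-- Irreducibility DESCENDS from the pseudo-marginal chain to the marginal chain: a positive-probability
path of `P̃` from `(x, ξ)` to `(y, ξ')` projects to a positive-probability path of `P = mhKernel T π`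
from `x` to `y` (moves of the state are possible moves of `P` by `mhRate_pos_of_kernel_pos`; moves of
the noise alone are dropped).  (The converse, "`P̃` is also irreducible … if the marginal kernel `P`
is", is the remark printed in Andrieu–Vihola 2015, §8; private helper.) [folklore] -/
private theorem isIrreducible_mhKernel_of_kernel {f : X → Ξ → ℝ} {g : Ξ → ℝ} {π : X → ℝ}
    (hf : ∀ x ξ, 0 < f x ξ) (hg : ∀ ξ, 0 < g ξ) (hg1 : ∑ ξ, g ξ = 1) (hπ : ∀ x, 0 < π x)
    {T : X → X → ℝ} (hT : ∀ x y, 0 ≤ T x y) (hTrow : ∀ x, ∑ y, T x y ≤ 1)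
    (hirr : IsIrreducible (kernel T f g : Matrix (X × Ξ) (X × Ξ) ℝ)) :
    IsIrreducible (mhKernel T π : Matrix X X ℝ) := by
  -- name the two kernels AS MATRICES (so that `^` below is the matrix power)
  set K : Matrix (X × Ξ) (X × Ξ) ℝ := kernel T f g with hK_def
  set P : Matrix X X ℝ := mhKernel T π with hP_def
  have hPnn : ∀ a b, 0 ≤ P a b := fun a b => by
    rw [hP_def]; exact mhKernel_nonneg hT hTrow hπ a b
  have hKnn : ∀ z z', 0 ≤ K z z' := fun z z' => by
    rw [hK_def]; exact (kernel_isRowStochastic hf hg hg1 hT hTrow).1 z z'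
  -- a genuine move of `P̃` is a possible move of `P`
  have hmove : ∀ (a b : X) (ζ ζ' : Ξ), a ≠ b → 0 < K (a, ζ) (b, ζ') → 0 < P a b := by
    intro a b ζ ζ' hab hpos
    rw [hK_def] at hpos
    rw [hP_def, show mhKernel T π a b = mhRate T π a b from mhKernel_of_ne (Ne.symm hab)]
    exact mhRate_pos_of_kernel_pos hf hg hπ hT hab hpos
  have key : ∀ (n : ℕ) (z z' : X × Ξ), 0 < (K ^ n) z z' → ∃ m : ℕ, 0 < (P ^ m) z.1 z'.1 := by
    intro n
    induction n with
    | zero =>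
        intro z z' h
        rw [pow_zero, Matrix.one_apply] at h
        split_ifs at h with hzz
        · subst hzz
          exact ⟨0, by rw [pow_zero, Matrix.one_apply_eq]; norm_num⟩
        · exact absurd h (lt_irrefl 0)
    | succ n ih =>
        intro z z'' h
        rw [pow_succ, Matrix.mul_apply] at h
        obtain ⟨z', -, hz'⟩ : ∃ z' ∈ (univ : Finset (X × Ξ)), 0 < (K ^ n) z z' * K z' z'' := by
          by_contra hcon
          push Not at hcon
          exact absurd (sum_nonpos hcon) (not_le.mpr h)
        obtain ⟨h1, h2⟩ := pos_and_pos_of_mul_pos (pow_apply_nonneg hKnn n z z') (hKnn z' z'') hz'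
        obtain ⟨m, hm⟩ := ih z z' h1
        obtain ⟨a, ζ⟩ := z'
        obtain ⟨b, ζ'⟩ := z''
        by_cases hab : a = b
        · subst hab
          exact ⟨m, hm⟩
        · refine ⟨m + 1, ?_⟩
          have hstep : 0 < P a b := hmove a b ζ ζ' hab h2
          calc (0 : ℝ) < (P ^ m) z.1 a * P a b := mul_pos hm hstep
            _ ≤ ∑ c, (P ^ m) z.1 c * P c b :=
                single_le_sum (f := fun c => (P ^ m) z.1 c * P c b)
                  (fun c _ => mul_nonneg (pow_apply_nonneg hPnn m _ _) (hPnn _ _)) (mem_univ a)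
            _ = (P ^ (m + 1)) z.1 b := by rw [pow_succ, Matrix.mul_apply]
  -- the noise space is inhabited (`Σ g = 1`)
  rcases isEmpty_or_nonempty Ξ with hΞ | ⟨⟨ξ⟩⟩
  · simp at hg1
  intro x y
  obtain ⟨n, hn⟩ := hirr (x, ξ) (y, ξ)
  exact key n (x, ξ) (y, ξ) hn

/-! ## Theorem 7: the pseudo-marginal algorithm is dominated in asymptotic variance -/

section Variance

variable {f : X → Ξ → ℝ} {g : Ξ → ℝ} {π : X → ℝ} {T : X → X → ℝ}

omit [Fintype X] [DecidableEq X] [Fintype Ξ] [DecidableEq Ξ] in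
/-- The extended weight is positive (private helper). [folklore] -/
private theorem target_pos' (hf : ∀ x ξ, 0 < f x ξ) (hg : ∀ ξ, 0 < g ξ) (z : X × Ξ) :
    0 < target f g z :=
  mul_pos (hg z.2) (hf z.1 z.2)

/-- **The finite face of (eq:var-bound)** — the EXACT second-order identity behind Theorem 7: with
`P = mhKernel T π`, `P̃ = kernel T f g`, `ū = centred π u`, `h = Z_P ū` (the centred Poisson solution
of the marginal chain, `fundamentalMatrix_poisson`), `h̃ = lift h` and `Z̃ = fundamentalMatrix π̃ P̃`,
`v(ũ, π̃, P̃) − v(u, π, P) = 2[𝓔_P(h) − 𝓔_P̃(h̃)] + 2 𝓔_P̃(Z̃ (lift ū) − h̃)`.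
The first bracket is the printed first-order term `⟨f̄, A'_λ(0)f̄⟩ = 2λ⟨φ_λ,(P̃ − P̄)φ_λ⟩_π̃
= λ[Δ_P̄(g_λ) − Δ_P̃(g_λ)]` at `λ = 1` (`φ_λ → h`; `two_mul_dirichletForm_sub_eq`), the second the
printed non-negative remainder `∫∫⟨f̄, A''_λ(γ)f̄⟩ dγ dβ`; here both come at once from the
variational identity `2⟨ḡ, w⟩ − 𝓔(w) = ⟨ḡ, Z ḡ⟩ − 𝓔(Z ḡ − w)` of the extended chain at the lifted
marginal solution `w = h̃` (a function of `x` only — "Proposition 2 does not apply to functions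
depending also on `u` and `w`"), together with `var(f, P̄) = var(f, P)` in the form `piInner_lift`.
[cite: AndrieuVihola2015, Theorem 7 and §3 (its proof, display (eq:var-bound))];
[cite: AndrieuVihola2016, §4 Lemma 16 (the variational representation)] -/
theorem asympVar_lift_sub_asympVar_eq (hf : ∀ x ξ, 0 < f x ξ) (hg : ∀ ξ, 0 < g ξ)
    (hg1 : ∑ ξ, g ξ = 1) (hunb : ∀ x, ∑ ξ, g ξ * f x ξ = π x) (hπ : ∀ x, 0 < π x)
    (hπ1 : ∑ x, π x = 1) (hT : ∀ x y, 0 ≤ T x y) (hTrow : ∀ x, ∑ y, T x y ≤ 1)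
    (hirr : IsIrreducible (kernel T f g : Matrix (X × Ξ) (X × Ξ) ℝ)) (u : X → ℝ) :
    asympVar (lift u : X × Ξ → ℝ) (target f g) (kernel T f g) - asympVar u π (mhKernel T π) =
      2 * (dirichletForm π (mhKernel T π) (fundamentalMatrix π (mhKernel T π) *ᵥ centred π u)
          - dirichletForm (target f g) (kernel T f g)
              (lift (fundamentalMatrix π (mhKernel T π) *ᵥ centred π u) : X × Ξ → ℝ))
      + 2 * dirichletForm (target f g) (kernel T f g)
          (fundamentalMatrix (target f g) (kernel T f g) *ᵥ (lift (centred π u) : X × Ξ → ℝ)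
            - lift (fundamentalMatrix π (mhKernel T π) *ᵥ centred π u)) := by
  -- the two chains and their standing properties
  have hP : IsRowStochastic (mhKernel T π) := mhKernel_isRowStochastic hT hTrow hπ
  have hDB : DetailedBalance π (mhKernel T π) := mhKernel_detailedBalance hπ T
  have hst : IsStationary π (mhKernel T π) := hDB.isStationary hP.2
  have hKrow : IsRowStochastic (kernel T f g) := kernel_isRowStochastic hf hg hg1 hT hTrow
  have hDB' : DetailedBalance (target f g) (kernel T f g) := kernel_detailedBalance hf hg T
  have hst' : IsStationary (target f g) (kernel T f g) := hDB'.isStationary hKrow.2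
  have hπ'1 : ∑ z : X × Ξ, target f g z = 1 := by rw [sum_target_univ hunb, hπ1]
  have hirrP : IsIrreducible (mhKernel T π : Matrix X X ℝ) :=
    isIrreducible_mhKernel_of_kernel hf hg hg1 hπ hT hTrow hirr
  have hK := isUnit_fundamentalInv hπ1 hP hst hirrP
  have hK' := isUnit_fundamentalInv hπ'1 hKrow hst' hirr
  -- the centred observable `uc`, its lift, the marginal Poisson solution `h` and its lift
  have huc : ∑ x, π x * centred π u x = 0 := sum_mul_centred hπ1 u
  have hlift : centred (target f g) (lift u : X × Ξ → ℝ) = lift (centred π u) :=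
    centred_lift hunb u
  have huc' : ∑ z : X × Ξ, target f g z * (lift (centred π u) : X × Ξ → ℝ) z = 0 := by
    rw [sum_target_mul_lift hunb, huc]
  -- (ii) at λ = 1: the two variances in centred form (`asympVar_eq_centred`)
  have e1 := asympVar_eq_centred hπ1 hP hst hK u
  have e2 := asympVar_eq_centred hπ'1 hKrow hst' hK' (lift u : X × Ξ → ℝ)
  rw [hlift] at e2
  -- (i) marginal coincidence of moments (`var(f, P̄) = var(f, P)`)
  have e3 : piInner (target f g) (lift (centred π u) : X × Ξ → ℝ) (lift (centred π u)) =
      piInner π (centred π u) (centred π u) := piInner_lift hunb _ _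
  have e4 : piInner (target f g) (lift (centred π u) : X × Ξ → ℝ)
      (lift (fundamentalMatrix π (mhKernel T π) *ᵥ centred π u)) =
      piInner π (centred π u) (fundamentalMatrix π (mhKernel T π) *ᵥ centred π u) :=
    piInner_lift hunb _ _
  -- (iii)+(iv) the variational identity of the extended chain at the LIFTED marginal solution
  have e5 := variational_identity hπ'1 hKrow hDB' hK' huc'
    (lift (fundamentalMatrix π (mhKernel T π) *ᵥ centred π u) : X × Ξ → ℝ)
  -- the marginal solution's Dirichlet form `𝓔_P(h) = ⟨ū, h⟩_π`
  have e6 : dirichletForm π (mhKernel T π) (fundamentalMatrix π (mhKernel T π) *ᵥ centred π u) =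
      piInner π (centred π u) (fundamentalMatrix π (mhKernel T π) *ᵥ centred π u) :=
    dirichletForm_fundamentalMatrix_mulVec hπ1 hP hst hK huc
  linarith [e1, e2, e3, e4, e5, e6]

/-- **Andrieu–Vihola 2015, Theorem 7 (ii)** (finite form, `λ = 1`): "More specifically,
`var(f, P̃) ≥ var(f, P) + liminf_{λ→1−}[Δ_P̄(g_λ) − Δ_P̃(g_λ)]` where
`g_λ(x,y) := [φ_λ(x) − φ_λ(y)]²` with `φ_λ(x) := Σ_k λᵏ[Pᵏf(x) − π(f)]`" — for a finite irreducible
chain `φ_λ → h = Z_P f̄` and the bound reads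
`v(ũ, π̃, P̃) ≥ v(u, π, P) + 2[𝓔_P(h) − 𝓔_P̃(h̃)]` (`= Δ_P̄(g_h) − Δ_P̃(g_h)` by
`two_mul_dirichletForm_sub_eq`); proof: drop the non-negative remainder of
`asympVar_lift_sub_asympVar_eq` ("because the first term is always non-negative").
[cite: AndrieuVihola2015, Theorem 7 (ii)] -/
theorem asympVar_le_asympVar_lift' (hf : ∀ x ξ, 0 < f x ξ) (hg : ∀ ξ, 0 < g ξ)
    (hg1 : ∑ ξ, g ξ = 1) (hunb : ∀ x, ∑ ξ, g ξ * f x ξ = π x) (hπ : ∀ x, 0 < π x)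
    (hπ1 : ∑ x, π x = 1) (hT : ∀ x y, 0 ≤ T x y) (hTrow : ∀ x, ∑ y, T x y ≤ 1)
    (hirr : IsIrreducible (kernel T f g : Matrix (X × Ξ) (X × Ξ) ℝ)) (u : X → ℝ) :
    asympVar u π (mhKernel T π)
        + 2 * (dirichletForm π (mhKernel T π) (fundamentalMatrix π (mhKernel T π) *ᵥ centred π u)
          - dirichletForm (target f g) (kernel T f g)
              (lift (fundamentalMatrix π (mhKernel T π) *ᵥ centred π u) : X × Ξ → ℝ)) ≤
      asympVar (lift u : X × Ξ → ℝ) (target f g) (kernel T f g) := by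
  have hid := asympVar_lift_sub_asympVar_eq hf hg hg1 hunb hπ hπ1 hT hTrow hirr u
  have hrem : 0 ≤ dirichletForm (target f g) (kernel T f g)
      (fundamentalMatrix (target f g) (kernel T f g) *ᵥ (lift (centred π u) : X × Ξ → ℝ)
        - lift (fundamentalMatrix π (mhKernel T π) *ᵥ centred π u)) :=
    dirichletForm_nonneg (fun z => (target_pos' hf hg z).le)
      (kernel_isRowStochastic hf hg hg1 hT hTrow).1 _
  linarith

/-- **ANDRIEU–VIHOLA 2015, THEOREM 7 (i)** (finite form): "We now show that a pseudo-marginal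
algorithm is always dominated by its associated marginal algorithm in terms of asymptotic variance …
Assume `f : X → ℝ` … Denote `var(f, P̃) = var(f̃, P̃)` where `f̃(x, ·) ≡ f(x)`.  Then,
`var(f, P̃) ≥ var(f, P)`."  Here: for a positive unbiased estimator `f` of the probability vector `π`
(noise law `g`), a non-negative proposal matrix `T` with row sums `≤ 1` and an irreducible
pseudo-marginal chain, `v(u, π, mhKernel T π) ≤ v(ũ, π̃, kernel T f g)` for EVERY observable `u` of
the state — the noise of the estimate can only RAISE the asymptotic variance, whatever the proposal.
Proof: Theorem 7 (ii) and `𝓔_P̃(h̃) ≤ 𝓔_P(h)` (`dirichletForm_lift_le`, Proposition 2).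
[cite: AndrieuVihola2015, Theorem 7 (i)]; [cite: AndrieuVihola2016, Theorem 10 (c) with Remark 14
(the marginal algorithm as the case `Q_x ≡ δ_1`)] -/
theorem asympVar_le_asympVar_lift (hf : ∀ x ξ, 0 < f x ξ) (hg : ∀ ξ, 0 < g ξ)
    (hg1 : ∑ ξ, g ξ = 1) (hunb : ∀ x, ∑ ξ, g ξ * f x ξ = π x) (hπ : ∀ x, 0 < π x)
    (hπ1 : ∑ x, π x = 1) (hT : ∀ x y, 0 ≤ T x y) (hTrow : ∀ x, ∑ y, T x y ≤ 1)
    (hirr : IsIrreducible (kernel T f g : Matrix (X × Ξ) (X × Ξ) ℝ)) (u : X → ℝ) :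
    asympVar u π (mhKernel T π) ≤ asympVar (lift u : X × Ξ → ℝ) (target f g) (kernel T f g) := by
  have h2 := asympVar_le_asympVar_lift' hf hg hg1 hunb hπ hπ1 hT hTrow hirr u
  have h1 := dirichletForm_lift_le hf hg hg1 hunb hπ T
    (fundamentalMatrix π (mhKernel T π) *ᵥ centred π u)
  linarith

omit [DecidableEq X] [DecidableEq Ξ] in
/-- The stationary variance of a lifted observable is that of the observable:
`‖centred π̃ ũ‖²_π̃ = ‖ū‖²_π` (`var_π̃(f̃) = var_π(f)`). [cite: AndrieuVihola2015, §2 Definition 6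
(`var_μ(f) := μ((f − μ(f))²)`) and §3 (proof of Theorem 7, "coincides marginally")] -/
theorem piInner_centred_lift (hunb : ∀ x, ∑ ξ, g ξ * f x ξ = π x) (u : X → ℝ) :
    piInner (target f g) (centred (target f g) (lift u : X × Ξ → ℝ))
        (centred (target f g) (lift u : X × Ξ → ℝ)) =
      piInner π (centred π u) (centred π u) := by
  rw [centred_lift hunb, piInner_lift hunb]

/-- **Theorem 7 (i) for the integrated autocorrelation times**: since `ũ` and `u` have the same
stationary variance `var_π̃(ũ) = var_π(u)` (`piInner_centred_lift`), the order of the asymptotic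
variances is an order of their ratios to it — of `τ(f, P̃) ≥ τ(f, P)` in the normalisation
`var(f, Π) = τ(f, Π) var_μ(f)` ("whenever the integrated autocorrelation time … exists and is finite,
then `var(f, Π) = τ(f, Π) var_μ(f)`"). [cite: AndrieuVihola2015, §2 Definition 6 and Theorem 7 (i)] -/
theorem asympVar_div_var_le (hf : ∀ x ξ, 0 < f x ξ) (hg : ∀ ξ, 0 < g ξ)
    (hg1 : ∑ ξ, g ξ = 1) (hunb : ∀ x, ∑ ξ, g ξ * f x ξ = π x) (hπ : ∀ x, 0 < π x)
    (hπ1 : ∑ x, π x = 1) (hT : ∀ x y, 0 ≤ T x y) (hTrow : ∀ x, ∑ y, T x y ≤ 1)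
    (hirr : IsIrreducible (kernel T f g : Matrix (X × Ξ) (X × Ξ) ℝ)) (u : X → ℝ) :
    asympVar u π (mhKernel T π) / piInner π (centred π u) (centred π u) ≤
      asympVar (lift u : X × Ξ → ℝ) (target f g) (kernel T f g) /
        piInner (target f g) (centred (target f g) (lift u : X × Ξ → ℝ))
          (centred (target f g) (lift u : X × Ξ → ℝ)) := by
  rw [piInner_centred_lift hunb]
  exact div_le_div_of_nonneg_right (asympVar_le_asympVar_lift hf hg hg1 hunb hπ hπ1 hT hTrow hirr u)
    (sum_nonneg fun x _ => mul_nonneg (hπ x).le (mul_self_nonneg _))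

end Variance

end PseudoMarginal

end Literature.Probability.MarkovChains
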